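import Literature.MathematicalPhysics.QuantumLattice.GrassmannWardIdentity
import Summits.HubbardSuperconductivity.HubbardSuperconductivity.Theorems.AposterioriCapRgSeededBrokenRegimeBoseFermiPinnedChargeNeutrality
import Summits.HubbardSuperconductivity.HubbardSuperconductivity.Theorems.AposterioriCapRgSeededBrokenRegimeBoseFermiPinnedSeedSliceBound
import Summits.HubbardSuperconductivity.HubbardSuperconductivity.Theorems.AposterioriCapRgSeededBrokenRegimeBoseFermiPinnedSeedSliceCovarianceBound

/-!
# The seed Ward identity of the countertermed Hubbard torus, Boltzmann form
# (crux `SeededBrokenRegimeBoseFermiPinned` = stmt-HubbardSuperconductivity-14047, route AposterioriCapRg)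

Support file (`--supports stmt-HubbardSuperconductivity-14047`).  The crux's informal statement names as the FIRST
LEMMA of its flow "the WARD IDENTITY (`ψ ↦ e^{iθ/2}ψ` makes every `θ`-coupling at zero momentum a derivative
coupling or the seed; SalmhoferEtAl2004 §4.2, EberleinMetzner2014 §III)".  Its exact finite-volume Grassmann form
for the MODEL is assembled here from the tree's generic Ward identity of the Gaussian convolution
(`Literature/…/GrassmannWardIdentity.lean`, `chargeOp_effBoltzmann`) and the landed seed calculus of this crux
(S1 `stub_seedSliceBound`, S3 `stub_seedSliceCovarianceBound`, S10b's zero-seed charge conservation):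

* `chargeOp_hubbardInteractionCT` — the interaction slot `V_K = V + 𝒩_K` (Hubbard vertex plus quadratic counterterm)
  is NEUTRAL under the global `U(1)` charge `q(ψ⁺) = 1`, `q(ψ⁻) = -1`: `N_q V_K = 0`.
* `hubbardCovAboveCT_zero_seed_of_charge_eq`, `chargeWeighted_hubbardCovAboveCT_zero_seed` — without seed the CT
  covariance above any scale pairs only opposite charges: its charge-weighted covariance `C_q` VANISHES.
* `chargeWeighted_hubbardCovAboveCT_apply`, `norm_chargeWeighted_hubbardCovAboveCT_le` — with seed `h`, `C_q` is
  `±2` times the ANOMALOUS (same-charge) blocks of `C^{K,>Λ}_h` and is of size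
  `‖C_q(X,Y)‖ ≤ 64√2 · βL² · |h| / Λ²`, i.e. LINEAR IN THE SEED, uniformly in the frame, `μ`, `M` (S1 + S3 at `h₀ = 0`).
* **`seedWard_hubbardEffBoltzmannCT`** — THE SEED WARD IDENTITY (Boltzmann form): the effective Boltzmann factor
  `B^K_{Λ,h} = μ_{C^{K,>Λ}_h} ⋆ e^{-V_K}` of the seeded torus satisfies `N_q B + Δ_{C_q} B = 0`; on kernels
  (`kernel_seedWard_hubbardEffBoltzmannCT`): `(#ψ⁺ - #ψ⁻)(X) · B_m(X) = -(Δ_{C_q} B)_m(X)` — every CHARGED kernel of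
  `B` is the contraction of the kernels two degrees up with a covariance of size `O(h βL²/Λ²)`: the anomalous
  (charge-`±2`) vertices of the seeded flow are generated by the seed alone, with an explicit linear-in-`h` handle —
  the exact pin behind "transverse mass `∝ h`" at every finite `(L, M, β)`, any frame `K`, any scale `Λ`.
* `kernel_hubbardEffBoltzmannCT_zero_seed_eq_zero` — at `h = 0` every charged kernel of `B` vanishes (the Boltzmann
  companion of S10b `stub_chargeNeutrality`, which states it for the effective action).

No analysis beyond the landed S1/S3 bound; all identities are exact algebra in the finite Grassmann algebra.
Sources: SalmhoferEtAl2004 §4.2; EberleinMetzner2014 §III; BenfattoGiulianiMastropietro2006 §2.1 (symmetry (2));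
Salmhofer1999 §4.3 — as cited in `GrassmannWardIdentity.lean`; the model instance is folklore bookkeeping.
-/

set_option linter.dupNamespace false -- `Summit.<S>.<S>` doubles the summit name (tree convention)

namespace Summit.HubbardSuperconductivity.HubbardSuperconductivity.Theorems.AposterioriCapRgSeededBrokenRegimeBoseFermiPinned

open Literature.MathematicalPhysics.QuantumLattice Literature.Probability.LatticeModels GrassmannAlgebra

variable {L M : ℕ}

/-! ### The `U(1)` charge and the neutrality of the interaction slot -/

/-- The charge operator of `q(ψ⁺) = 1`, `q(ψ⁻) = -1` fixes `ψ̂⁺_{kσ}`. [folklore] -/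
theorem chargeOp_psiPlus [NeZero L] (k : FreqMomentum L M) (σ : Fin 2) :
    chargeOp ℂ (fun X : HubbardFieldIdx L M => if X.2 = 0 then (1:ℂ) else -1) (psiPlus k σ) = psiPlus k σ := by
  rw [psiPlus, chargeOp_gen, if_pos rfl, one_smul]

/-- The charge operator of `q(ψ⁺) = 1`, `q(ψ⁻) = -1` negates `ψ̂⁻_{kσ}`. [folklore] -/
theorem chargeOp_psiMinus [NeZero L] (k : FreqMomentum L M) (σ : Fin 2) :
    chargeOp ℂ (fun X : HubbardFieldIdx L M => if X.2 = 0 then (1:ℂ) else -1) (psiMinus k σ) = -psiMinus k σ := by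
  rw [psiMinus, chargeOp_gen, if_neg (show ¬ ((1 : Fin 2) = 0) from one_ne_zero), neg_one_smul]

/-- A normal quartic monomial `ψ⁺ψ⁻ψ⁺ψ⁻` is neutral. [folklore] -/
theorem chargeOp_psiPlus_psiMinus_psiPlus_psiMinus [NeZero L] (k₁ k₂ k₃ k₄ : FreqMomentum L M)
    (σ₁ σ₂ σ₃ σ₄ : Fin 2) :
    chargeOp ℂ (fun X : HubbardFieldIdx L M => if X.2 = 0 then (1:ℂ) else -1)
      (psiPlus k₁ σ₁ * psiMinus k₂ σ₂ * psiPlus k₃ σ₃ * psiMinus k₄ σ₄) = 0 := by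
  rw [chargeOp_mul, chargeOp_mul, chargeOp_mul, chargeOp_psiPlus, chargeOp_psiMinus, chargeOp_psiPlus,
    chargeOp_psiMinus]
  noncomm_ring

/-- A normal quadratic monomial `ψ⁺ψ⁻` is neutral. [folklore] -/
theorem chargeOp_psiPlus_psiMinus [NeZero L] (k₁ k₂ : FreqMomentum L M) (σ₁ σ₂ : Fin 2) :
    chargeOp ℂ (fun X : HubbardFieldIdx L M => if X.2 = 0 then (1:ℂ) else -1) (psiPlus k₁ σ₁ * psiMinus k₂ σ₂) = 0 := by
  rw [chargeOp_mul, chargeOp_psiPlus, chargeOp_psiMinus]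
  noncomm_ring

/-- **The interaction slot is neutral**: `N_q (V + 𝒩_K) = 0` for the Hubbard vertex plus the quadratic counterterm of
any frame `K` (BGM 2006 §2.1, symmetry (2), for the vertex; the counterterm is `Σ K ψ⁺ψ⁻`). [folklore] -/
theorem chargeOp_hubbardInteractionCT :
    ∀ (L M : ℕ) [NeZero L] (β U : ℝ) (K : TrigPolyC4v), chargeOp ℂ (fun X : HubbardFieldIdx L M => if X.2 = 0
      then (1:ℂ) else -1) (hubbardInteractionCT L M β U K) = 0 := by
  intro L M _ β U K
  rw [hubbardInteractionCT, map_add]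
  have hV : chargeOp ℂ (fun X : HubbardFieldIdx L M => if X.2 = 0 then (1:ℂ) else -1) (hubbardInteraction L M β U) = 0 := by
    simp only [hubbardInteraction, map_smul, map_sum]
    refine smul_eq_zero_of_right _ (Finset.sum_eq_zero fun k₁ _ => Finset.sum_eq_zero fun k₂ _ =>
      Finset.sum_eq_zero fun k₃ _ => Finset.sum_eq_zero fun k₄ _ => ?_)
    split_ifs
    · exact chargeOp_psiPlus_psiMinus_psiPlus_psiMinus k₁ k₂ k₃ k₄ 0 0 1 1
    · exact map_zero _
  have hN : chargeOp ℂ (fun X : HubbardFieldIdx L M => if X.2 = 0 then (1:ℂ) else -1) (counterQuadratic L M β K) = 0 := by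
    simp only [counterQuadratic, map_sum, map_smul, chargeOp_psiPlus_psiMinus, smul_zero, Finset.sum_const_zero]
  rw [hV, hN, add_zero]

/-! ### The charge-weighted CT covariance: zero without seed, linear in the seed -/

/-- **Without seed the CT covariance above scale pairs only opposite charges**: its same-charge (anomalous) entries
vanish, in every frame `K`, at every scale `Λ`. [folklore] -/
theorem hubbardCovAboveCT_zero_seed_of_charge_eq :
    ∀ (L M : ℕ) [NeZero L] (β μ : ℝ) (K : TrigPolyC4v) (Λ : ℝ) (X Y : HubbardFieldIdx L M), X.2 = Y.2 →
      hubbardCovAboveCT L M β μ 0 K Λ X Y = 0 := by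
  intro L M _ β μ K Λ X Y hXY
  have h := hubbardCovAboveCT_zero_seed_chargeScale (L := L) (M := M) 2 two_ne_zero β μ K Λ X Y
  obtain ⟨x, c⟩ := X
  obtain ⟨y, c'⟩ := Y
  simp only at hXY
  subst hXY
  fin_cases c
  · simp only [Fin.zero_eta, Fin.isValue, ↓reduceIte] at h ⊢
    linear_combination (-4 / 3 : ℂ) * h
  · simp only [Fin.mk_one, Fin.isValue, one_ne_zero, ↓reduceIte] at h ⊢
    linear_combination (1 / 3 : ℂ) * h

/-- The sum of the charges of two labels: `±2` for equal charge indices, `0` otherwise. [folklore] -/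
theorem charge_add_charge (X Y : HubbardFieldIdx L M) :
    ((if X.2 = 0 then (1:ℂ) else -1) + (if Y.2 = 0 then (1:ℂ) else -1)) =
      if X.2 = Y.2 then (if X.2 = 0 then (2:ℂ) else -2) else 0 := by
  obtain ⟨x, c⟩ := X
  obtain ⟨y, c'⟩ := Y
  fin_cases c <;> fin_cases c' <;> norm_num

/-- **The charge-weighted CT covariance is `±2` times the anomalous blocks**:
`C_q(X, Y) = (q(X) + q(Y)) C(X, Y)` is `2 C` on `ψ⁺ψ⁺`, `-2 C` on `ψ⁻ψ⁻`, `0` on normal pairs. [folklore] -/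
theorem chargeWeighted_hubbardCovAboveCT_apply :
    ∀ (L M : ℕ) [NeZero L] (β μ h : ℝ) (K : TrigPolyC4v) (Λ : ℝ) (X Y : HubbardFieldIdx L M),
      chargeWeighted ℂ (fun X : HubbardFieldIdx L M => if X.2 = 0 then (1:ℂ) else -1) (hubbardCovAboveCT L M β μ h K Λ) X Y =
        (if X.2 = Y.2 then (if X.2 = 0 then (2:ℂ) else -2) else 0) * hubbardCovAboveCT L M β μ h K Λ X Y := by
  intro L M _ β μ h K Λ X Y
  rw [chargeWeighted_apply, charge_add_charge]

/-- **Without seed the charge-weighted CT covariance vanishes** (`C_q = 0` at `h = 0`). [folklore] -/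
theorem chargeWeighted_hubbardCovAboveCT_zero_seed :
    ∀ (L M : ℕ) [NeZero L] (β μ : ℝ) (K : TrigPolyC4v) (Λ : ℝ),
      chargeWeighted ℂ (fun X : HubbardFieldIdx L M => if X.2 = 0 then (1:ℂ) else -1) (hubbardCovAboveCT L M β μ 0 K Λ) = 0 := by
  intro L M _ β μ K Λ
  ext X Y
  rw [chargeWeighted_hubbardCovAboveCT_apply, Matrix.zero_apply]
  by_cases hXY : X.2 = Y.2
  · rw [hubbardCovAboveCT_zero_seed_of_charge_eq L M β μ K Λ X Y hXY, mul_zero]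
  · rw [if_neg hXY, zero_mul]

/-- **The charge-weighted CT covariance is linear in the seed**:
`‖C_q(X, Y)‖ ≤ 64√2 · βL² · |h| / Λ²` for `β, Λ > 0`, uniformly in the frame `K`, `μ`, `M` — twice the S3 Lipschitz
bound between the seeds `h` and `0`, where the anomalous blocks vanish. [folklore] -/
theorem norm_chargeWeighted_hubbardCovAboveCT_le :
    ∀ (L M : ℕ) [NeZero L] (β μ h : ℝ) (K : TrigPolyC4v) (Λ : ℝ) (X Y : HubbardFieldIdx L M), 0 < β → 0 < Λ →
      ‖chargeWeighted ℂ (fun X : HubbardFieldIdx L M => if X.2 = 0 then (1:ℂ) else -1) (hubbardCovAboveCT L M β μ h K Λ) X Y‖ ≤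
        64 * Real.sqrt 2 * β * (L : ℝ) ^ 2 * |h| / Λ ^ 2 := by
  intro L M _ β μ h K Λ X Y hβ hΛ
  rw [chargeWeighted_hubbardCovAboveCT_apply]
  by_cases hXY : X.2 = Y.2
  · rw [if_pos hXY, norm_mul]
    have hC : ‖hubbardCovAboveCT L M β μ h K Λ X Y‖ ≤ 32 * Real.sqrt 2 * β * (L : ℝ) ^ 2 * |h| / Λ ^ 2 := by
      have := stub_seedSliceCovarianceBound stub_seedSliceBound L M β μ h 0 K Λ X Y hβ hΛ
      rwa [hubbardCovAboveCT_zero_seed_of_charge_eq L M β μ K Λ X Y hXY, sub_zero, sub_zero] at this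
    have h2 : ‖(if X.2 = 0 then (2:ℂ) else -2)‖ = 2 := by split_ifs <;> simp
    rw [h2]
    calc 2 * ‖hubbardCovAboveCT L M β μ h K Λ X Y‖ ≤ 2 * (32 * Real.sqrt 2 * β * (L : ℝ) ^ 2 * |h| / Λ ^ 2) := by
          gcongr
      _ = 64 * Real.sqrt 2 * β * (L : ℝ) ^ 2 * |h| / Λ ^ 2 := by ring
  · rw [if_neg hXY, zero_mul, norm_zero]
    positivity

/-! ### The seed Ward identity of the effective Boltzmann factor -/

/-- **THE SEED WARD IDENTITY (Boltzmann form)**: the effective Boltzmann factor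
`B = μ_{C^{K,>Λ}_h} ⋆ e^{-(V + 𝒩_K)}` of the seeded countertermed Hubbard torus satisfies `N_q B + Δ_{C_q} B = 0` with
`C_q` the (`O(h)`, anomalous) charge-weighted covariance — every finite `L ≥ 1`, `M`, `β`, `U`, `μ`, seed `h`,
frame `K`, scale `Λ`. [cite: SalmhoferEtAl2004, §4.2] -/
theorem seedWard_hubbardEffBoltzmannCT :
    ∀ (L M : ℕ) [NeZero L] (β U μ h : ℝ) (K : TrigPolyC4v) (Λ : ℝ),
      chargeOp ℂ (fun X : HubbardFieldIdx L M => if X.2 = 0 then (1:ℂ) else -1)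
          (effBoltzmann ℂ (hubbardCovAboveCT L M β μ h K Λ) (hubbardInteractionCT L M β U K)) +
        grassmannLaplacian ℂ (chargeWeighted ℂ (fun X : HubbardFieldIdx L M => if X.2 = 0 then (1:ℂ) else -1)
          (hubbardCovAboveCT L M β μ h K Λ)) (effBoltzmann ℂ (hubbardCovAboveCT L M β μ h K Λ) (hubbardInteractionCT L M β U K)) = 0 := by
  intro L M _ β U μ h K Λ
  exact chargeOp_effBoltzmann ℂ _ _ (chargeOp_hubbardInteractionCT L M β U K)

/-- **The seed Ward identity on kernels**: `(Σᵢ q(Xᵢ)) · B_m(X) = -(Δ_{C_q} B)_m(X)` — a kernel of the effective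
Boltzmann factor with `#ψ⁺ ≠ #ψ⁻` legs is `-(#ψ⁺ - #ψ⁻)⁻¹` times the contraction of the kernels two degrees up with
the `O(h βL²/Λ²)` charge-weighted covariance. [folklore] -/
theorem kernel_seedWard_hubbardEffBoltzmannCT :
    ∀ (L M : ℕ) [NeZero L] (β U μ h : ℝ) (K : TrigPolyC4v) (Λ : ℝ) (m : ℕ) (X : Fin m → HubbardFieldIdx L M),
      (∑ i, (if (X i).2 = 0 then (1:ℂ) else -1)) *
          kernel ℂ (effBoltzmann ℂ (hubbardCovAboveCT L M β μ h K Λ) (hubbardInteractionCT L M β U K)) m X =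
        -kernel ℂ (grassmannLaplacian ℂ (chargeWeighted ℂ (fun X : HubbardFieldIdx L M => if X.2 = 0 then (1:ℂ) else -1)
          (hubbardCovAboveCT L M β μ h K Λ)) (effBoltzmann ℂ (hubbardCovAboveCT L M β μ h K Λ) (hubbardInteractionCT L M β U K))) m X := by
  intro L M _ β U μ h K Λ m X
  exact kernel_effBoltzmann_ward ℂ _ _ (chargeOp_hubbardInteractionCT L M β U K) m X

/-- The total charge of a label string is `#ψ⁺ - #ψ⁻`. [folklore] -/
theorem sum_charge_eq_card_sub_card {m : ℕ} (X : Fin m → HubbardFieldIdx L M) :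
    (∑ i, (if (X i).2 = 0 then (1:ℂ) else -1)) =
      ((Finset.univ.filter fun i => (X i).2 = 0).card : ℂ) - ((Finset.univ.filter fun i => (X i).2 = 1).card : ℂ) := by
  rw [Finset.sum_ite, Finset.sum_const, Finset.sum_const, filter_charge_ne_zero_eq]
  simp only [nsmul_eq_mul, mul_one, mul_neg]
  ring

/-- **Without seed every charged kernel of the effective Boltzmann factor vanishes**: at `h = 0` the kernels of
`B = μ_{C^{K,>Λ}_0} ⋆ e^{-(V + 𝒩_K)}` with `#ψ⁺ ≠ #ψ⁻` legs are zero (the Boltzmann companion of S10b). [folklore] -/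
theorem kernel_hubbardEffBoltzmannCT_zero_seed_eq_zero :
    ∀ (L M : ℕ) [NeZero L] (β U μ : ℝ) (K : TrigPolyC4v) (Λ : ℝ) (m : ℕ) (X : Fin m → HubbardFieldIdx L M),
      (Finset.univ.filter fun i => (X i).2 = 0).card ≠ (Finset.univ.filter fun i => (X i).2 = 1).card →
        kernel ℂ (effBoltzmann ℂ (hubbardCovAboveCT L M β μ 0 K Λ) (hubbardInteractionCT L M β U K)) m X = 0 := by
  intro L M _ β U μ K Λ m X hne
  refine kernel_effBoltzmann_eq_zero_of_chargeWeighted_eq_zero ℂ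
    (fun X : HubbardFieldIdx L M => if X.2 = 0 then (1:ℂ) else -1)
    (chargeWeighted_hubbardCovAboveCT_zero_seed L M β μ K Λ) (chargeOp_hubbardInteractionCT L M β U K) ?_
  intro h0
  apply hne
  have h1 : ((Finset.univ.filter fun i => (X i).2 = 0).card : ℂ) =
      ((Finset.univ.filter fun i => (X i).2 = 1).card : ℂ) := by
    have := sum_charge_eq_card_sub_card X
    rw [h0] at this
    linear_combination -this
  exact_mod_cast h1

end Summit.HubbardSuperconductivity.HubbardSuperconductivity.Theorems.AposterioriCapRgSeededBrokenRegimeBoseFermiPinned
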